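import Literature.Geometry.Lorentzian.KerrCarterPointwise
import Literature.Geometry.Lorentzian.OpensChartGeodesicODE
import Literature.Geometry.Lorentzian.ChartMetricCoord
import Literature.Geometry.Lorentzian.KerrStationaryBlackHole
import Literature.Geometry.Lorentzian.KerrAxialKillingField
import Literature.Geometry.Lorentzian.TrappedZeroEnergyRay
import HarnessLib

/-!
# Carter's constant is conserved along the null geodesics of the Kerr metric

(family `gr`; namespace `Literature.Geometry.Lorentzian.Kerr`; all results proved; sequel to
`KerrCarterPointwise.lean`.)

**Theorem** (`Kerr.ksCarterK_eq_of_isGeodesicOn`; Carter 1968; O'Neill 1995, Ch. 4, Thm. 4.2.2,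
"Carter's constant"). Let `γ` be a geodesic of the Kerr metric `g_{M,a}` (`Kerr.smoothMetric M a r₀`,
ingoing Kerr–Schild Cartesian chart, any real `M, a, r₀`) on an order-connected set `s` of
parameters, null on `s` and off the horizons there (`Δ(r(γ t)) ≠ 0` for `t ∈ s`). Then the
Kerr–Schild expression of Carter's constant `𝒦 = (ℙ² − Σ²ρ²)/Δ` (`Kerr.ksCarterK`: `ℙ = E(r² + a²) − aL`
from the Killing energies `E = Kerr.ksEnergy`, `L = Kerr.ksAngMom`; `ρ = dr(γ')`) takes the same value
at any two parameters of `s`.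

Proof (the classical one, Carter 1968, §IV; O'Neill 1995, pp. 180–183, organised around the
radial equation `Σ² ṙ² = ℙ² − Δ𝒦`): read `γ` in the chart (`OpensChartGeodesicODE.lean`: the
coordinate curve has derivative `γ'`, the velocity has derivative `−Γ(γ', γ')`), so that `ṙ = ρ`,
`ρ̇ = Hess r(γ', γ')` (the coordinate Hessian `MetricCoord.hessAt` of the Kerr–Schild radius),
`Σ̇ = dΣ(γ')`; `E`, `L` are conserved (`∂_{t*}` and `x∂_y − y∂_x` are Killing,
`KerrStationaryBlackHole.lean`, `KerrAxialKillingField.lean`, and O'Neill 1983, Ch. 9, Lemma 9.26,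
`TrappedZeroEnergyRay.lean`), and `g(γ', γ') = 0`; then
`(ℙ² − Σ²ρ²)˙ Δ − (ℙ² − Σ²ρ²) Δ̇ = −ρ · [Δ·2Σ² Hess r(γ',γ') − Δ(4Erℙ − 2Σρσ) + (2r − 2M)(ℙ² − Σ²ρ²)] = 0`
by the tangency-free radial-acceleration identity `Kerr.delta_mul_hessAt_radius_eq` of
`KerrRadiusPseudoconvexityKS.lean` (the `r`-geodesic equation as a pointwise identity, axis included).
No Killing tensor is needed.

## References

* B. Carter, *Global structure of the Kerr family of gravitational fields*, Phys. Rev. 174 (1968)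
  1559–1571, §IV. Key `Carter1968`.
* B. O'Neill, *The geometry of Kerr black holes*, A K Peters 1995, Ch. 4, §4.2, Thm. 4.2.2.
  Key `ONeill1995`.
* B. O'Neill, *Semi-Riemannian geometry* (1983), Ch. 3, Cor. 3.21 and Lemma 3.49; Ch. 9, Lemma 9.26.
  Key `ONeillSemiRiemannian1983`.
-/

noncomputable section

set_option maxSynthPendingDepth 3

open Set Function Module Real Bundle
open scoped Topology ContDiff Manifold
open Literature.Geometry.Lorentzian.MetricCoord

namespace Literature.Geometry.Lorentzian

namespace Kerr

variable [Facts] {M a r₀ : ℝ} [(smoothMetric M a r₀).HasLeviCivita]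

/-! ### The coordinate curve, the velocity and the radius along a geodesic of the chart -/

section AlongGeodesic

variable {γ : ℝ → region a r₀} {s : Set ℝ}
  (hγ : IsGeodesicOn (smoothMetric M a r₀).toPseudoRiemannianMetric.leviCivita γ s)
include hγ

/-- **The geodesic equations in the Kerr–Schild chart**: along a geodesic of `g_{M,a}` the
coordinate curve has derivative the velocity `w = γ'(t)`, and the velocity has derivative
`−Γ_{γ t}(w, w)`, `Γ = chrAt (Kerr.bilin M a)` the coordinate Christoffel map of the Kerr–Schild
components (O'Neill 1983, Ch. 3, Cor. 3.21; the tree's `OpensChart.hasDerivAt_of_isGeodesicOn`,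
`OpensChart.christoffel_eq_chrAt`). [cite: ONeillSemiRiemannian1983, Ch. 3, Cor. 21] -/
theorem hasDerivAt_coe_and_velocity {t : ℝ} (ht : t ∈ s) :
    HasDerivAt (fun t' ↦ (γ t' : E4)) (velocity 𝓘(ℝ, E4) γ t) t ∧
      HasDerivAt (fun t' ↦ (velocity 𝓘(ℝ, E4) γ t' : E4))
        (-chrAt (Kerr.bilin M a) (γ t) (velocity 𝓘(ℝ, E4) γ t) (velocity 𝓘(ℝ, E4) γ t)) t := by
  have hG : ∀ y : region a r₀, (smoothMetric M a r₀).toPseudoRiemannianMetric.val y = Kerr.bilin M a y :=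
    fun y ↦ rfl
  have hGd : ∀ y : region a r₀, DifferentiableAt ℝ (Kerr.bilin M a) y := differentiableAt_bilin M a
  obtain ⟨h1, h2⟩ := OpensChart.hasDerivAt_of_isGeodesicOn hG hGd hγ ht
  refine ⟨h1, ?_⟩
  rw [OpensChart.christoffel_eq_chrAt hG] at h2
  exact h2

/-- **`ṙ = dr(γ')`** along a geodesic of the chart (chain rule). [folklore] -/
theorem hasDerivAt_radius_comp {t : ℝ} (ht : t ∈ s) :
    HasDerivAt (fun t' ↦ radius a (γ t'))
      (fderiv ℝ (radius a) (γ t) (velocity 𝓘(ℝ, E4) γ t)) t := by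
  have hx : 0 < radius a (γ t) := radius_pos_of_mem_region (γ t).2
  have hd : DifferentiableAt ℝ (radius a) (γ t) :=
    (contDiffAt_radius hx (n := 1)).differentiableAt one_ne_zero
  exact hd.hasFDerivAt.comp_hasDerivAt t (hasDerivAt_coe_and_velocity hγ ht).1

/-- **`(dr(γ'))˙ = Hess r(γ', γ')`** along a geodesic of the chart: the derivative of
`ρ(t) = dr_{γ t}(γ' t)` is `D²r(γ', γ') − dr(Γ(γ', γ')) = hessAt (Kerr.bilin M a) r (γ t) (γ' t) (γ' t)`
(product rule and the geodesic equation; O'Neill 1983, Ch. 3, Def. 3.48–Lemma 3.49).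
[cite: ONeillSemiRiemannian1983, Ch. 3, Lemma 49] -/
theorem hasDerivAt_fderiv_radius_comp {t : ℝ} (ht : t ∈ s) :
    HasDerivAt (fun t' ↦ fderiv ℝ (radius a) (γ t') (velocity 𝓘(ℝ, E4) γ t'))
      (hessAt (Kerr.bilin M a) (radius a) (γ t) (velocity 𝓘(ℝ, E4) γ t) (velocity 𝓘(ℝ, E4) γ t))
      t := by
  have hx : 0 < radius a (γ t) := radius_pos_of_mem_region (γ t).2
  obtain ⟨hc, hv⟩ := hasDerivAt_coe_and_velocity hγ ht
  have hd2 : DifferentiableAt ℝ (fderiv ℝ (radius a)) (γ t) :=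
    ((contDiffAt_radius hx (n := 2)).fderiv_right (m := 1) (by norm_num)).differentiableAt
      one_ne_zero
  have hA : HasDerivAt (fun t' ↦ fderiv ℝ (radius a) (γ t'))
      (fderiv ℝ (fderiv ℝ (radius a)) (γ t) (velocity 𝓘(ℝ, E4) γ t)) t :=
    hd2.hasFDerivAt.comp_hasDerivAt t hc
  have h := hA.clm_apply hv
  refine h.congr_deriv ?_
  rw [hessAt_apply, map_neg]
  abel

/-- **`Σ̇ = dΣ(γ')`** along a geodesic of the chart, `Σ = Kerr.blSigma a ∘ spatial`. [folklore] -/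
theorem hasDerivAt_blSigma_comp {t : ℝ} (ht : t ∈ s) :
    HasDerivAt (fun t' ↦ blSigma a (E4.spatial (γ t' : E4)))
      (fderiv ℝ (fun z : E4 ↦ blSigma a (E4.spatial z)) (γ t) (velocity 𝓘(ℝ, E4) γ t)) t := by
  have hx : 0 < radius a (γ t) := radius_pos_of_mem_region (γ t).2
  have hd : DifferentiableAt ℝ (fun z : E4 ↦ blSigma a (E4.spatial z)) (γ t) :=
    (Ingoing.contDiffAt_blSigma_spatial hx (n := 1)).differentiableAt one_ne_zero
  exact hd.hasFDerivAt.comp_hasDerivAt t (hasDerivAt_coe_and_velocity hγ ht).1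

/-- **The Killing energy is conserved**: `t ↦ E(γ t, γ' t) = −g(∂_{t*}, γ')` has derivative `0`
along a geodesic (`∂_{t*}` is Killing, `Kerr.isKillingField_stationaryField_smoothMetric`;
O'Neill 1983, Ch. 9, Lemma 9.26). [cite: ONeillSemiRiemannian1983, Ch. 9, Lemma 26] -/
theorem hasDerivAt_ksEnergy_comp {t : ℝ} (ht : t ∈ s) :
    HasDerivAt (fun t' ↦ ksEnergy M a (γ t') (velocity 𝓘(ℝ, E4) γ t')) 0 t := by
  have h := (smoothMetric M a r₀).toPseudoRiemannianMetric.hasDerivAt_val_killing_velocity_of_isGeodesicOn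
    (isKillingField_stationaryField_smoothMetric M a r₀) hγ ht
  have h' := h.neg
  simp only [neg_zero] at h'
  exact h'

/-- **The axial angular momentum is conserved**: `t ↦ L(γ t, γ' t) = g(x∂_y − y∂_x, γ')` has
derivative `0` along a geodesic (`Kerr.isKillingField_axialField_smoothMetric`).
[cite: ONeillSemiRiemannian1983, Ch. 9, Lemma 26] -/
theorem hasDerivAt_ksAngMom_comp {t : ℝ} (ht : t ∈ s) :
    HasDerivAt (fun t' ↦ ksAngMom M a (γ t') (velocity 𝓘(ℝ, E4) γ t')) 0 t := by
  have h := (smoothMetric M a r₀).toPseudoRiemannianMetric.hasDerivAt_val_killing_velocity_of_isGeodesicOn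
    (isKillingField_axialField_smoothMetric M a r₀) hγ ht
  have he : (fun t' ↦ (smoothMetric M a r₀).toPseudoRiemannianMetric.val (γ t')
      (axialField a r₀ (γ t')) (velocity 𝓘(ℝ, E4) γ t')) =
      fun t' ↦ ksAngMom M a (γ t') (velocity 𝓘(ℝ, E4) γ t') := by
    funext t'
    rw [axialField_eq_axialGenerator]
    rfl
  rw [he] at h
  exact h

/-- **`g(γ', γ')` is constant**: derivative `0` along a geodesic (O'Neill 1983, Ch. 3, p. 69).
[cite: ONeillSemiRiemannian1983, Ch. 3, p. 69] -/
theorem hasDerivAt_bilin_velocity {t : ℝ} (ht : t ∈ s) :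
    HasDerivAt (fun t' ↦ Kerr.bilin M a (γ t') (velocity 𝓘(ℝ, E4) γ t') (velocity 𝓘(ℝ, E4) γ t'))
      0 t := by
  have hcov : (smoothMetric M a r₀).toPseudoRiemannianMetric.IsCompatible
      (smoothMetric M a r₀).toPseudoRiemannianMetric.leviCivita :=
    (PseudoRiemannianMetric.isLeviCivita_leviCivita_holds
      (g := (smoothMetric M a r₀).toPseudoRiemannianMetric)).2
  exact (smoothMetric M a r₀).toPseudoRiemannianMetric.hasDerivAt_val_velocity_of_isGeodesicOn hcov hγ ht

/-- **Conservation of Carter's constant along null geodesics of Kerr** (Carter 1968; O'Neill 1995,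
Ch. 4, Thm. 4.2.2). Along a geodesic of `g_{M,a}` in the Kerr–Schild chart which is null at the
parameter `t` and off the horizons there (`Δ(r(γ t)) ≠ 0`), the Kerr–Schild expression
`𝒦 = (ℙ² − Σ²ρ²)/Δ` (`ℙ = E(r² + a²) − aL`, `ρ = dr(γ')`) has derivative `0` at `t`: with
`E, L` conserved, `ṙ = ρ`, `ρ̇ = Hess r(γ', γ')`, `Σ̇ = dΣ(γ')`, the numerator of `(ℙ² − Σ²ρ²)˙Δ − (ℙ² − Σ²ρ²)Δ̇`
is `ρ` times the tangency-free radial-acceleration identity `Kerr.delta_mul_hessAt_radius_eq`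
(`Δ·2Σ² Hess r = Δ(4Erℙ − 2Σρσ) − (2r − 2M)(ℙ² − Σ²ρ²)` on the null cone).
[cite: ONeill1995, Ch. 4, Thm. 4.2.2] -/
theorem hasDerivAt_carter_zero {t : ℝ} (ht : t ∈ s)
    (hnull : Kerr.bilin M a (γ t) (velocity 𝓘(ℝ, E4) γ t) (velocity 𝓘(ℝ, E4) γ t) = 0)
    (hΔ : radius a (γ t) ^ 2 - 2 * M * radius a (γ t) + a ^ 2 ≠ 0) :
    HasDerivAt (fun t' ↦
      ((ksEnergy M a (γ t') (velocity 𝓘(ℝ, E4) γ t') * (radius a (γ t') ^ 2 + a ^ 2) -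
            a * ksAngMom M a (γ t') (velocity 𝓘(ℝ, E4) γ t')) ^ 2 -
          blSigma a (E4.spatial (γ t' : E4)) ^ 2 *
            fderiv ℝ (radius a) (γ t') (velocity 𝓘(ℝ, E4) γ t') ^ 2) /
        (radius a (γ t') ^ 2 - 2 * M * radius a (γ t') + a ^ 2)) 0 t := by
  have hx : 0 < radius a (γ t) := radius_pos_of_mem_region (γ t).2
  -- the functions of `t` and their derivatives
  have hE := hasDerivAt_ksEnergy_comp hγ ht
  have hL := hasDerivAt_ksAngMom_comp hγ ht
  have hr := hasDerivAt_radius_comp hγ ht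
  have hρ := hasDerivAt_fderiv_radius_comp hγ ht
  have hSig := hasDerivAt_blSigma_comp hγ ht
  -- abbreviations for the values at `t`
  set w : E4 := velocity 𝓘(ℝ, E4) γ t with hw
  set E := ksEnergy M a (γ t) w with hEdef
  set L := ksAngMom M a (γ t) w with hLdef
  set r := radius a (γ t) with hrdef
  set ρ := fderiv ℝ (radius a) (γ t) w with hρdef
  set S := blSigma a (E4.spatial (γ t : E4)) with hSdef
  set σ := fderiv ℝ (fun z : E4 ↦ blSigma a (E4.spatial z)) (γ t) w with hσdef
  set H := hessAt (Kerr.bilin M a) (radius a) (γ t) w w with hHdef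
  -- numerator and denominator
  have hP : HasDerivAt (fun t' ↦ ksEnergy M a (γ t') (velocity 𝓘(ℝ, E4) γ t') *
      (radius a (γ t') ^ 2 + a ^ 2) - a * ksAngMom M a (γ t') (velocity 𝓘(ℝ, E4) γ t'))
      (0 * (r ^ 2 + a ^ 2) + E * (2 * r ^ 1 * ρ + 0) - a * 0) t :=
    (hE.mul ((hr.pow 2).add (hasDerivAt_const t (a ^ 2)))).sub (hL.const_mul a)
  have hN : HasDerivAt (fun t' ↦
      (ksEnergy M a (γ t') (velocity 𝓘(ℝ, E4) γ t') * (radius a (γ t') ^ 2 + a ^ 2) -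
          a * ksAngMom M a (γ t') (velocity 𝓘(ℝ, E4) γ t')) ^ 2 -
        blSigma a (E4.spatial (γ t' : E4)) ^ 2 * fderiv ℝ (radius a) (γ t') (velocity 𝓘(ℝ, E4) γ t') ^ 2)
      (2 * (E * (r ^ 2 + a ^ 2) - a * L) ^ 1 * (0 * (r ^ 2 + a ^ 2) + E * (2 * r ^ 1 * ρ + 0) - a * 0) -
        (2 * S ^ 1 * σ * ρ ^ 2 + S ^ 2 * (2 * ρ ^ 1 * H))) t :=
    (hP.pow 2).sub ((hSig.pow 2).mul (hρ.pow 2))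
  have hD : HasDerivAt (fun t' ↦ radius a (γ t') ^ 2 - 2 * M * radius a (γ t') + a ^ 2)
      (2 * r ^ 1 * ρ - 2 * M * ρ + 0) t :=
    ((hr.pow 2).sub (hr.const_mul (2 * M))).add (hasDerivAt_const t (a ^ 2))
  have hq := hN.div hD hΔ
  refine hq.congr_deriv ?_
  -- the radial-acceleration identity on the null cone
  have key := delta_mul_hessAt_radius_eq (M := M) hx w
  rw [hnull] at key
  simp only [mul_zero, add_zero] at key
  simp only [← hEdef, ← hLdef, ← hrdef, ← hρdef, ← hSdef, ← hσdef, ← hHdef] at key ⊢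
  rw [div_eq_zero_iff]
  left
  simp only [pow_one]
  linear_combination (-ρ) * key

/-- **Carter's constant has derivative `0` along a null geodesic off the horizons**
(`Kerr.ksCarterK`, the Kerr–Schild expression `(ℙ² − Σ²ρ²)/Δ`). [cite: ONeill1995, Ch. 4, Thm. 4.2.2] -/
theorem hasDerivAt_ksCarterK {t : ℝ} (ht : t ∈ s)
    (hnull : Kerr.bilin M a (γ t) (velocity 𝓘(ℝ, E4) γ t) (velocity 𝓘(ℝ, E4) γ t) = 0)
    (hΔ : radius a (γ t) ^ 2 - 2 * M * radius a (γ t) + a ^ 2 ≠ 0) :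
    HasDerivAt (fun t' ↦ ksCarterK M a (γ t') (velocity 𝓘(ℝ, E4) γ t')) 0 t :=
  hasDerivAt_carter_zero hγ ht hnull hΔ

/-- **Conservation of Carter's constant** (Carter 1968; O'Neill 1995, Ch. 4, Thm. 4.2.2): along a
geodesic of the Kerr metric on an order-connected parameter set `s`, null and off the horizons on
`s`, the Kerr–Schild expression `𝒦 = (ℙ² − Σ²ρ²)/Δ` of Carter's constant takes the same value at
any two parameters of `s`. [cite: ONeill1995, Ch. 4, Thm. 4.2.2] -/
theorem ksCarterK_eq_of_isGeodesicOn (hsc : s.OrdConnected)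
    (hnull : ∀ t ∈ s, Kerr.bilin M a (γ t) (velocity 𝓘(ℝ, E4) γ t) (velocity 𝓘(ℝ, E4) γ t) = 0)
    (hΔ : ∀ t ∈ s, radius a (γ t) ^ 2 - 2 * M * radius a (γ t) + a ^ 2 ≠ 0)
    {t₁ t₂ : ℝ} (ht₁ : t₁ ∈ s) (ht₂ : t₂ ∈ s) :
    ksCarterK M a (γ t₁) (velocity 𝓘(ℝ, E4) γ t₁) = ksCarterK M a (γ t₂) (velocity 𝓘(ℝ, E4) γ t₂) :=
  apply_eq_apply_of_hasDerivAt_zero hsc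
    (fun t ht ↦ hasDerivAt_ksCarterK hγ ht (hnull t ht) (hΔ t ht)) ht₁ ht₂

/-- **The Killing energy is constant** along a geodesic on an order-connected parameter set.
[cite: ONeillSemiRiemannian1983, Ch. 9, Lemma 26] -/
theorem ksEnergy_eq_of_isGeodesicOn (hsc : s.OrdConnected) {t₁ t₂ : ℝ} (ht₁ : t₁ ∈ s) (ht₂ : t₂ ∈ s) :
    ksEnergy M a (γ t₁) (velocity 𝓘(ℝ, E4) γ t₁) = ksEnergy M a (γ t₂) (velocity 𝓘(ℝ, E4) γ t₂) :=
  apply_eq_apply_of_hasDerivAt_zero hsc (fun _ ht ↦ hasDerivAt_ksEnergy_comp hγ ht) ht₁ ht₂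

/-- **The axial angular momentum is constant** along a geodesic on an order-connected parameter set.
[cite: ONeillSemiRiemannian1983, Ch. 9, Lemma 26] -/
theorem ksAngMom_eq_of_isGeodesicOn (hsc : s.OrdConnected) {t₁ t₂ : ℝ} (ht₁ : t₁ ∈ s) (ht₂ : t₂ ∈ s) :
    ksAngMom M a (γ t₁) (velocity 𝓘(ℝ, E4) γ t₁) = ksAngMom M a (γ t₂) (velocity 𝓘(ℝ, E4) γ t₂) :=
  apply_eq_apply_of_hasDerivAt_zero hsc (fun _ ht ↦ hasDerivAt_ksAngMom_comp hγ ht) ht₁ ht₂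

end AlongGeodesic

end Kerr

end Literature.Geometry.Lorentzian

end
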